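import Mathlib
import Summits.Ventures.PercRepro2.K5HyperCoeffs3
import Summits.Ventures.PercRepro2.K5HyperK3CmpB
import Summits.Ventures.PercRepro2.K5StarBridgeDict

/-!
# THE CRUX KERNEL'S STAR COMPARISONS AT THE COINCIDENCE MARKINGS AS COEFFICIENT INEQUALITIES AT EVERY `K₅` PROFILE
(blind cell PercRepro2, typer-1 g11; mine-1 §23.12 at the three `MarksDistinct` markings `b ∈ {4, 3, 0}`)

p2's `cPosOn3b b / cNegOn3b b` (`K5StarBridgeDict.lean`, with `posOn3b_eq`, `cPosOn3b_le`, …) are the masked triple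
counts of the `10 + 10` products of `K₃` at the marking `(0, 1, 2, 3, b)` (at `b = 4` they are g10's `cPosOn3 / cNegOn3`,
`cPosOn3b_four`); the Kronecker numbers of `K5HyperK3CmpB.lean` encode their placement sums (`posOn3b_eq`, the new
base-`2^25` `posOn35b_eq`, the generic `sumT1_eq` … of `K5HyperCoeffsI.lean` and the base-`2^25` twins `sumT1_eq5`,
`sumE3_eq5`).  Coefficient bounds as in
`K5HyperCoeffs3.lean`: `M-TRI` `120 · 3^10 < 2^23`, `TvT-TRI` `300 · 3^10 < 2^25`.  Hence

* **`cNegM3b_le_cPosM3b`**: `M-TRI ≥ 0` at the marking `b`, every `K₅` profile, from its certificate;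
* **`cNegTvT3b_le_cPosTvT3b`**: `TvT-TRI ≥ 0` at the marking `b` (base `2^25`).
-/

namespace Summit.Ventures.PercRepro2

namespace K5

section Coeffs3B

/-- At the distinct marking these are g10's `cPosOn3`. -/
theorem cPosOn3b_four : cPosOn3b 4 = cPosOn3 := rfl

/-- At the distinct marking these are g10's `cNegOn3`. -/
theorem cNegOn3b_four : cNegOn3b 4 = cNegOn3 := rfl

/-- `posOn35b b` encodes `cPosOn3b b` (base `2^25`). -/
lemma posOn35b_eq (b : ℕ) (S₁ S₂ S₃ : Fin 10 → Bool) :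
    posOn35b b S₁ S₂ S₃ = ∑ k, cPosOn3b b S₁ S₂ S₃ k * KB5 ^ idx4 k := by
  unfold posOn35b
  simp only [kron35_mul_mul, sum_add_mulB5]
  rfl

/-- `negOn35b b` encodes `cNegOn3b b` (base `2^25`). -/
lemma negOn35b_eq (b : ℕ) (S₁ S₂ S₃ : Fin 10 → Bool) :
    negOn35b b S₁ S₂ S₃ = ∑ k, cNegOn3b b S₁ S₂ S₃ k * KB5 ^ idx4 k := by
  unfold negOn35b
  simp only [kron35_mul_mul, sum_add_mulB5]
  rfl

/-- The positive side of `M-TRI` at the marking `b`: `N(H+T(1)+e(1))⁺ + N(H+T(1))⁻`. -/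
def cPosM3b (b : ℕ) (D P : Fin 10 → Bool) (k : Fin 10 → Fin 4) : ℕ :=
  csumT1e1 (cPosOn3b b) D P k + csumT1 (cNegOn3b b) D k

/-- The negative side of `M-TRI` at the marking `b`. -/
def cNegM3b (b : ℕ) (D P : Fin 10 → Bool) (k : Fin 10 → Fin 4) : ℕ :=
  csumT1e1 (cNegOn3b b) D P k + csumT1 (cPosOn3b b) D k

/-- The positive side of `TvT-TRI` at the marking `b` on the triangle `{x, y, z}`:
`N(H+△(1,1,1))⁺ + N(H+T(1))⁻`. -/
def cPosTvT3b (b x y z : ℕ) (k : Fin 10 → Fin 4) : ℕ :=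
  csumE3 (cPosOn3b b) (pairMask x y) (pairMask x z) (pairMask y z) k + csumT1 (cNegOn3b b) (triMask x y z) k

/-- The negative side of `TvT-TRI` at the marking `b`. -/
def cNegTvT3b (b x y z : ℕ) (k : Fin 10 → Fin 4) : ℕ :=
  csumE3 (cNegOn3b b) (pairMask x y) (pairMask x z) (pairMask y z) k + csumT1 (cPosOn3b b) (triMask x y z) k

/-- `kPosM3b b` encodes `cPosM3b b`. -/
lemma kPosM3b_eq (b : ℕ) (D P : Fin 10 → Bool) : kPosM3b b D P = ∑ k, cPosM3b b D P k * KB3 ^ idx4 k := by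
  unfold kPosM3b
  rw [sumT1e1_eq (cPosOn3b b) (posOn3b b) (posOn3b_eq b), sumT1_eq (cNegOn3b b) (negOn3b b) (negOn3b_eq b),
    sum_add_mulB]
  rfl

/-- `kNegM3b b` encodes `cNegM3b b`. -/
lemma kNegM3b_eq (b : ℕ) (D P : Fin 10 → Bool) : kNegM3b b D P = ∑ k, cNegM3b b D P k * KB3 ^ idx4 k := by
  unfold kNegM3b
  rw [sumT1e1_eq (cNegOn3b b) (negOn3b b) (negOn3b_eq b), sumT1_eq (cPosOn3b b) (posOn3b b) (posOn3b_eq b),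
    sum_add_mulB]
  rfl

/-- `kPosTvT35b b` encodes `cPosTvT3b b` (base `2^25`). -/
lemma kPosTvT35b_eq (b x y z : ℕ) : kPosTvT35b b x y z = ∑ k, cPosTvT3b b x y z k * KB5 ^ idx4 k := by
  unfold kPosTvT35b
  rw [sumE3_eq5 (cPosOn3b b) (posOn35b b) (posOn35b_eq b), sumT1_eq5 (cNegOn3b b) (negOn35b b) (negOn35b_eq b),
    sum_add_mulB5]
  rfl

/-- `kNegTvT35b b` encodes `cNegTvT3b b` (base `2^25`). -/
lemma kNegTvT35b_eq (b x y z : ℕ) : kNegTvT35b b x y z = ∑ k, cNegTvT3b b x y z k * KB5 ^ idx4 k := by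
  unfold kNegTvT35b
  rw [sumE3_eq5 (cNegOn3b b) (negOn35b b) (negOn35b_eq b), sumT1_eq5 (cPosOn3b b) (posOn35b b) (posOn35b_eq b),
    sum_add_mulB5]
  rfl

/-- The `M-TRI` coefficients are below `KB3` (`120 · 3^10 < 2^23`). -/
lemma cPosM3b_lt (b : ℕ) (D P : Fin 10 → Bool) (k : Fin 10 → Fin 4) : cPosM3b b D P k < KB3 := by
  unfold cPosM3b; rw [KB3_val]
  have := csumT1e1_le (cPosOn3b b) (10 * 59049) (cPosOn3b_le b) D P k
  have := csumT1_le (cNegOn3b b) (10 * 59049) (cNegOn3b_le b) D k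
  omega

/-- The `M-TRI` coefficients are below `KB3`. -/
lemma cNegM3b_lt (b : ℕ) (D P : Fin 10 → Bool) (k : Fin 10 → Fin 4) : cNegM3b b D P k < KB3 := by
  unfold cNegM3b; rw [KB3_val]
  have := csumT1e1_le (cNegOn3b b) (10 * 59049) (cNegOn3b_le b) D P k
  have := csumT1_le (cPosOn3b b) (10 * 59049) (cPosOn3b_le b) D k
  omega

/-- The `TvT-TRI` coefficients are below `KB5` (`300 · 3^10 < 2^25`). -/
lemma cPosTvT3b_lt (b x y z : ℕ) (k : Fin 10 → Fin 4) : cPosTvT3b b x y z k < KB5 := by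
  unfold cPosTvT3b; rw [KB5_val]
  have := csumE3_le (cPosOn3b b) (10 * 59049) (cPosOn3b_le b) (pairMask x y) (pairMask x z) (pairMask y z) k
  have := csumT1_le (cNegOn3b b) (10 * 59049) (cNegOn3b_le b) (triMask x y z) k
  omega

/-- The `TvT-TRI` coefficients are below `KB5`. -/
lemma cNegTvT3b_lt (b x y z : ℕ) (k : Fin 10 → Fin 4) : cNegTvT3b b x y z k < KB5 := by
  unfold cNegTvT3b; rw [KB5_val]
  have := csumE3_le (cNegOn3b b) (10 * 59049) (cNegOn3b_le b) (pairMask x y) (pairMask x z) (pairMask y z) k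
  have := csumT1_le (cPosOn3b b) (10 * 59049) (cPosOn3b_le b) (triMask x y z) k
  omega

/-- **`M-TRI ≥ 0` at the marking `b`, every `K₅` profile**, from its certificate. -/
theorem cNegM3b_le_cPosM3b (b : ℕ) (D P : Fin 10 → Bool) (hc : CertLE (kNegM3b b D P) (kPosM3b b D P))
    (k : Fin 10 → Fin 4) : cNegM3b b D P k ≤ cPosM3b b D P k :=
  le_of_certLE (cPosM3b b D P) (cNegM3b b D P) (cPosM3b_lt b D P) (cNegM3b_lt b D P) (kPosM3b_eq b D P)
    (kNegM3b_eq b D P) hc k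

/-- **`TvT-TRI ≥ 0` at the marking `b`, every `K₅` profile**, from its base-`2^25` certificate. -/
theorem cNegTvT3b_le_cPosTvT3b (b x y z : ℕ) (hc : CertLE5 (kNegTvT35b b x y z) (kPosTvT35b b x y z))
    (k : Fin 10 → Fin 4) : cNegTvT3b b x y z k ≤ cPosTvT3b b x y z k :=
  le_of_certLE5 (cPosTvT3b b x y z) (cNegTvT3b b x y z) (cPosTvT3b_lt b x y z) (cNegTvT3b_lt b x y z)
    (kPosTvT35b_eq b x y z) (kNegTvT35b_eq b x y z) hc k

end Coeffs3B

end K5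

end Summit.Ventures.PercRepro2
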